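import Literature.NumberTheory.Transcendental.GaGmIsogeny
import Literature.NumberTheory.Transcendental.PhilipponZeroEstimateMultidegree
import Mathlib.LinearAlgebra.FreeModule.Finite.CardQuotient
import Mathlib.LinearAlgebra.FreeModule.PID
import HarnessLib

/-!
# The power isogenies of `G = 𝔾ₐ × 𝔾ₘⁿ`: pulled-back character lattices and their minors

Topic `Literature/NumberTheory/Transcendental`. Third part of the isogeny toolkit
(`GaGmIsogeny.lean`, `GaGmIsogenyIndex.lean`) for the reduction of Philippon's zero estimate with
unequal torus degrees (Nesterenko 2003, Prop. 5.1) to equal degrees. For a subgroup `Φ' ≤ ℤⁿ`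
(the characters trivial on the obstruction subgroup upstairs) and `k = (k_j)` with `k_j ≥ 1`, the
pulled-back lattice is `Φ = {χ ; kχ ∈ Φ'}` (the characters of the image subgroup downstairs,
`GaGm.ConnAlgSubgroup.isoImage`). This file proves that `Φ` has `ℤ`-bases with as many elements
as those of `Φ'`, and compares the `r × r` minors `|det M_I|` of Nesterenko's formula (5.7)
(`GaGm.absMinor`) for bases `M` of `Φ` and `M'` of `Φ'`:

  `|det M_I| · ∏_{i ∈ I} k_i = [Φ' : Φ' ∩ kℤⁿ] · |det M'_I|`   for every `I`,

because the rows of `M·diag(k)` form a basis of the finite-index sublattice `kΦ = Φ' ∩ kℤⁿ` of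
`Φ'`, and two bases of lattices `L₁ ≤ L₂` of the same rank differ by an integer matrix of
determinant `±[L₂ : L₁]` (`AddSubgroup.relIndex_eq_natAbs_det`). Everything here is PROVED; no
named facts, no new definitions.

* `exists_basis_of_rows`, `rows_linearIndependent_of_basis`, `closure_rows_of_basis` — the
  dictionary between "`r × n` integer matrix whose rows are a `ℤ`-basis of `Φ`" (the currency of
  `Nesterenko2003_prop51`) and `Basis (Fin r) ℤ Φ.toIntSubmodule`;
* `map_kmulHom_comap` (`k·Φ = Φ' ∩ kℤⁿ`), `finrank_toIntSubmodule_comap_kmulHom` (`rank Φ = rank Φ'`);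
* `absMinor_of_card_ne`, `absMinor_rowScale` (`|det (M diag k)_I| = |det M_I| ∏_{i∈I} k_i`);
* **`exists_basis_comap_kmulHom`** — given a basis `M'` of `Φ'` with `r` rows, a basis `M` of `Φ`
  with `r` rows and `|det M_I| · ∏_{i∈I} k_i = [Φ' : Φ' ∩ kℤⁿ] · |det M'_I|` for all `I`.

## References

* Yu. V. Nesterenko, *Linear forms in logarithms of rational numbers*, LNM 1819 (2003), §5.1,
  (5.7) (the matrix `M` of a basis of `Φ` and its minors `det M_{i₁,…,i_r}`).
* J. W. S. Cassels, *An Introduction to the Geometry of Numbers*, Classics in Mathematics, Springer 1997 (reprint of the 1971 ed.), Ch. I §2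
  (sublattices, index = |det| of the transition matrix).
-/

noncomputable section

open Module

namespace Literature.NumberTheory.Transcendental

namespace GaGm

variable {n : ℕ}

/-! ### Integer matrices whose rows are a basis of a subgroup of `ℤⁿ` -/

/-- From rows to a `Basis`: if the rows `M i` are `ℤ`-linearly independent and generate `Φ`, they
form a `ℤ`-basis of `Φ`. [cite: Cassels1997, Ch. I §2] -/
theorem exists_basis_of_rows {r : ℕ} {Φ : AddSubgroup (Fin n → ℤ)} (M : Fin r → (Fin n → ℤ))
    (hli : LinearIndependent ℤ M) (hsp : Φ = AddSubgroup.closure (Set.range M)) :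
    ∃ b : Basis (Fin r) ℤ ↥Φ.toIntSubmodule, ∀ i, ((b i : ↥Φ.toIntSubmodule) : Fin n → ℤ) = M i := by
  have hspan : (Submodule.span ℤ (Set.range M)).toAddSubgroup = Φ := by
    rw [Submodule.span_int_eq_addSubgroupClosure, ← hsp]
  have hmem : ∀ i, M i ∈ Φ.toIntSubmodule := fun i => by
    show M i ∈ Φ
    rw [hsp]
    exact AddSubgroup.subset_closure ⟨i, rfl⟩
  let v : Fin r → ↥Φ.toIntSubmodule := fun i => ⟨M i, hmem i⟩
  have hv : Φ.toIntSubmodule.subtype ∘ v = M := rfl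
  have hli' : LinearIndependent ℤ v :=
    LinearIndependent.of_comp Φ.toIntSubmodule.subtype (by rw [hv]; exact hli)
  have hsp' : ⊤ ≤ Submodule.span ℤ (Set.range v) := by
    rintro x -
    have hx : (x : Fin n → ℤ) ∈ Submodule.span ℤ (Set.range M) := by
      rw [← Submodule.mem_toAddSubgroup, hspan]
      exact x.2
    rw [← hv, Set.range_comp] at hx
    exact (Submodule.apply_mem_span_image_iff_mem_span (Submodule.injective_subtype _)).mp hx
  exact ⟨Basis.mk hli' hsp', fun i => by rw [Basis.mk_apply]⟩

/-- From a `Basis` to rows: the rows of a `ℤ`-basis of `Φ ≤ ℤⁿ` are `ℤ`-linearly independent in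
`ℤⁿ`. [cite: Cassels1997, Ch. I §2] -/
theorem rows_linearIndependent_of_basis {r : ℕ} {Φ : AddSubgroup (Fin n → ℤ)}
    (b : Basis (Fin r) ℤ ↥Φ.toIntSubmodule) :
    LinearIndependent ℤ (fun i => ((b i : ↥Φ.toIntSubmodule) : Fin n → ℤ)) :=
  b.linearIndependent.map' Φ.toIntSubmodule.subtype (Submodule.ker_subtype _)

/-- From a `Basis` to rows: the rows of a `ℤ`-basis of `Φ ≤ ℤⁿ` generate `Φ`.
[cite: Cassels1997, Ch. I §2] -/
theorem closure_rows_of_basis {r : ℕ} {Φ : AddSubgroup (Fin n → ℤ)}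
    (b : Basis (Fin r) ℤ ↥Φ.toIntSubmodule) :
    Φ = AddSubgroup.closure (Set.range fun i => ((b i : ↥Φ.toIntSubmodule) : Fin n → ℤ)) := by
  rw [← Submodule.span_int_eq_addSubgroupClosure,
    show (fun i => ((b i : ↥Φ.toIntSubmodule) : Fin n → ℤ)) = Φ.toIntSubmodule.subtype ∘ b from rfl,
    Set.range_comp, Submodule.span_image, b.span_eq, Submodule.map_top, Submodule.range_subtype,
    AddSubgroup.toIntSubmodule_toAddSubgroup]

/-! ### The pulled-back lattice `Φ = {χ ; kχ ∈ Φ'}` -/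

/-- `k·Φ = Φ' ∩ kℤⁿ` for `Φ = {χ ; kχ ∈ Φ'}` (as `ℤ`-submodules of `ℤⁿ`).
[cite: Nesterenko2003, §5.1] -/
theorem map_kmulHom_comap (k : Fin n → ℕ) (Φ' : AddSubgroup (Fin n → ℤ)) :
    (Φ'.comap (kmulHom k)).toIntSubmodule.map (kmulHom k).toIntLinearMap =
      ((kmulHom k).range ⊓ Φ').toIntSubmodule := by
  ext x
  simp only [Submodule.mem_map]
  constructor
  · rintro ⟨χ, hχ, rfl⟩
    exact ⟨⟨χ, rfl⟩, hχ⟩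
  · rintro ⟨⟨χ, rfl⟩, hx⟩
    exact ⟨χ, hx, rfl⟩

/-- `(∏ₗ kₗ)·ψ ∈ k·Φ` for `ψ ∈ Φ'`: the sublattice `k·Φ = Φ' ∩ kℤⁿ` has finite index in `Φ'`.
[cite: Nesterenko2003, §5.1] -/
theorem prod_smul_mem_map_kmulHom {k : Fin n → ℕ} (Φ' : AddSubgroup (Fin n → ℤ)) {ψ : Fin n → ℤ}
    (hψ : ψ ∈ Φ') :
    ((∏ j, k j : ℕ) : ℤ) • ψ ∈ (Φ'.comap (kmulHom k)).toIntSubmodule.map (kmulHom k).toIntLinearMap := by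
  set N : ℕ := ∏ j, k j with hN
  have hNdvd : ∀ j, k j ∣ N := fun j => Finset.dvd_prod_of_mem k (Finset.mem_univ j)
  have hkχ : kmulHom k (fun j => ((N / k j : ℕ) : ℤ) * ψ j) = (N : ℤ) • ψ := by
    funext j
    simp only [kmulHom_apply, Pi.smul_apply, smul_eq_mul, ← mul_assoc]
    congr 1
    rw [← Nat.cast_mul, Nat.mul_div_cancel' (hNdvd j)]
  refine ⟨fun j => ((N / k j : ℕ) : ℤ) * ψ j, ?_, hkχ⟩
  show kmulHom k _ ∈ Φ'
  rw [hkχ]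
  exact Φ'.zsmul_mem hψ _

/-- **`rank Φ = rank Φ'`** for `Φ = {χ ; kχ ∈ Φ'}` (`k_j ≥ 1`): `χ ↦ kχ` maps `Φ` isomorphically onto
`Φ' ∩ kℤⁿ`, which is sandwiched between `(∏ kₗ)Φ'` and `Φ'`. [cite: Nesterenko2003, §5.1] -/
theorem finrank_toIntSubmodule_comap_kmulHom {k : Fin n → ℕ} (hk : ∀ j, 1 ≤ k j)
    (Φ' : AddSubgroup (Fin n → ℤ)) :
    finrank ℤ ↥(Φ'.comap (kmulHom k)).toIntSubmodule = finrank ℤ ↥Φ'.toIntSubmodule := by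
  set Φ := Φ'.comap (kmulHom k) with hΦ
  set κ : (Fin n → ℤ) →ₗ[ℤ] (Fin n → ℤ) := (kmulHom k).toIntLinearMap with hκ
  have hκinj : Function.Injective κ := kmulHom_injective hk
  have h1 : finrank ℤ ↥(Φ.toIntSubmodule.map κ) = finrank ℤ ↥Φ.toIntSubmodule :=
    (LinearEquiv.finrank_eq (Submodule.equivMapOfInjective κ hκinj _)).symm
  have hle : Φ.toIntSubmodule.map κ ≤ Φ'.toIntSubmodule := by
    rw [hΦ, hκ, map_kmulHom_comap]
    exact fun x hx => hx.2
  have h2 : finrank ℤ ↥(Φ.toIntSubmodule.map κ) ≤ finrank ℤ ↥Φ'.toIntSubmodule := Submodule.finrank_mono hle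
  -- the lower bound through `(∏ kₗ)Φ' ≤ kΦ`
  set N : ℕ := ∏ j, k j with hN
  have hN0 : (N : ℤ) ≠ 0 := by
    rw [hN, Nat.cast_prod]
    exact Finset.prod_ne_zero_iff.mpr fun l _ => by exact_mod_cast (show k l ≠ 0 by have := hk l; omega)
  set μ : (Fin n → ℤ) →ₗ[ℤ] (Fin n → ℤ) := (N : ℤ) • LinearMap.id with hμ
  have hμinj : Function.Injective μ := fun x y hxy => by
    simp only [hμ, LinearMap.smul_apply, LinearMap.id_coe, id_eq] at hxy
    exact smul_right_injective _ hN0 hxy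
  have h3 : finrank ℤ ↥(Φ'.toIntSubmodule.map μ) = finrank ℤ ↥Φ'.toIntSubmodule :=
    (LinearEquiv.finrank_eq (Submodule.equivMapOfInjective μ hμinj _)).symm
  have hle2 : Φ'.toIntSubmodule.map μ ≤ Φ.toIntSubmodule.map κ := by
    rintro _ ⟨ψ, hψ, rfl⟩
    simp only [hμ, LinearMap.smul_apply, LinearMap.id_coe, id_eq]
    exact prod_smul_mem_map_kmulHom Φ' hψ
  have h4 : finrank ℤ ↥(Φ'.toIntSubmodule.map μ) ≤ finrank ℤ ↥(Φ.toIntSubmodule.map κ) :=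
    Submodule.finrank_mono hle2
  omega

/-! ### Minors -/

/-- `absMinor M I = 0` unless `card I = r`. [cite: Nesterenko2003, §5.1 (5.7)] -/
theorem absMinor_of_card_ne {r : ℕ} (M : Matrix (Fin r) (Fin n) ℤ) {I : Finset (Fin n)} (h : I.card ≠ r) :
    absMinor M I = 0 := by
  rw [absMinor, dif_neg h]

/-- `absMinor M I` for `card I = r`. [cite: Nesterenko2003, §5.1 (5.7)] -/
theorem absMinor_of_card_eq {r : ℕ} (M : Matrix (Fin r) (Fin n) ℤ) {I : Finset (Fin n)} (h : I.card = r) :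
    absMinor M I = (M.submatrix id (fun i => I.orderEmbOfFin h i)).det.natAbs := by
  rw [absMinor, dif_pos h]

/-- **Scaling the columns**: `|det (M·diag(k))_I| = |det M_I| · ∏_{i ∈ I} k_i`.
[cite: Nesterenko2003, §5.1 (5.7)] -/
theorem absMinor_rowScale {r : ℕ} (M : Matrix (Fin r) (Fin n) ℤ) (k : Fin n → ℕ) (I : Finset (Fin n)) :
    absMinor (Matrix.of fun i j => (k j : ℤ) * M i j) I = absMinor M I * ∏ j ∈ I, k j := by
  classical
  by_cases h : I.card = r
  · rw [absMinor_of_card_eq _ h, absMinor_of_card_eq _ h]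
    have hmat : (Matrix.of fun i j => (k j : ℤ) * M i j).submatrix id (fun i => I.orderEmbOfFin h i) =
        M.submatrix id (fun i => I.orderEmbOfFin h i) * Matrix.diagonal fun i => (k (I.orderEmbOfFin h i) : ℤ) := by
      ext i j
      simp [Matrix.mul_diagonal, mul_comm]
    rw [hmat, Matrix.det_mul, Matrix.det_diagonal, Int.natAbs_mul]
    congr 1
    rw [← Nat.cast_prod, Int.natAbs_natCast]
    -- `∏ i, k (e i) = ∏ j ∈ I, k j`
    conv_rhs => rw [← Finset.map_orderEmbOfFin_univ I h]
    rw [Finset.prod_map]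
    rfl
  · rw [absMinor_of_card_ne _ h, absMinor_of_card_ne _ h, zero_mul]

/-! ### Bases of `Φ` with the right number of rows, and the index identity for minors -/

/-- **Bases of the pulled-back lattice and their minors.** Let `Φ' ≤ ℤⁿ` with a `ℤ`-basis given by
the rows of `M' ∈ M_{r×n}(ℤ)`, `k_j ≥ 1`, and `Φ = {χ ; kχ ∈ Φ'}`. Then `Φ` has a `ℤ`-basis given by
the rows of some `M ∈ M_{r×n}(ℤ)` (same `r`), and for every `I`:
`|det M_I| · ∏_{i∈I} k_i = [Φ' : Φ' ∩ kℤⁿ] · |det M'_I|` — the rows of `M·diag(k)` are a basis of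
`kΦ = Φ' ∩ kℤⁿ`, and bases of `kΦ ≤ Φ'` differ by an integer matrix of determinant `±[Φ' : kΦ]`
(`AddSubgroup.relIndex_eq_natAbs_det`). [cite: Cassels1997, Ch. I §2] -/
theorem exists_basis_comap_kmulHom {k : Fin n → ℕ} (hk : ∀ j, 1 ≤ k j) {r : ℕ}
    {Φ' : AddSubgroup (Fin n → ℤ)} (M' : Matrix (Fin r) (Fin n) ℤ)
    (hli' : LinearIndependent ℤ (fun i => M' i)) (hsp' : Φ' = AddSubgroup.closure (Set.range fun i => M' i)) :
    ∃ M : Matrix (Fin r) (Fin n) ℤ, LinearIndependent ℤ (fun i => M i) ∧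
      Φ'.comap (kmulHom k) = AddSubgroup.closure (Set.range fun i => M i) ∧
      ∀ I : Finset (Fin n), absMinor M I * ∏ j ∈ I, k j = (kmulHom k).range.relIndex Φ' * absMinor M' I := by
  classical
  set Φ := Φ'.comap (kmulHom k) with hΦ
  -- the basis `b'` of `Φ'` and the rank
  obtain ⟨b', hb'⟩ := exists_basis_of_rows (fun i => M' i) hli' hsp'
  have hr' : finrank ℤ ↥Φ'.toIntSubmodule = r := by
    rw [finrank_eq_card_basis b', Fintype.card_fin]
  have hr : finrank ℤ ↥Φ.toIntSubmodule = r := by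
    rw [hΦ, finrank_toIntSubmodule_comap_kmulHom hk, hr']
  -- a basis `b` of `Φ` with `r` elements and its rows `M`
  let b : Basis (Fin r) ℤ ↥Φ.toIntSubmodule := Module.finBasisOfFinrankEq ℤ _ hr
  set M : Matrix (Fin r) (Fin n) ℤ := Matrix.of fun i j => ((b i : ↥Φ.toIntSubmodule) : Fin n → ℤ) j with hM
  have hMi : ∀ i, M i = ((b i : ↥Φ.toIntSubmodule) : Fin n → ℤ) := fun i => by
    funext j; rw [hM, Matrix.of_apply]
  have hMrow : (fun i => M i) = fun i => ((b i : ↥Φ.toIntSubmodule) : Fin n → ℤ) := funext hMi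
  refine ⟨M, by rw [hMrow]; exact rows_linearIndependent_of_basis b,
    by rw [hMrow]; exact closure_rows_of_basis b, fun I => ?_⟩
  -- the sublattice `L₁ = kℤⁿ ∩ Φ' = kΦ ≤ Φ'` and its basis `kM`
  set L₁ : AddSubgroup (Fin n → ℤ) := (kmulHom k).range ⊓ Φ' with hL₁
  have hle : L₁ ≤ Φ' := inf_le_right
  have hκmem : ∀ x : ↥Φ.toIntSubmodule, kmulHom k (x : Fin n → ℤ) ∈ L₁.toIntSubmodule := fun x =>
    ⟨⟨x, rfl⟩, x.2⟩
  let κ : ↥Φ.toIntSubmodule →ₗ[ℤ] ↥L₁.toIntSubmodule :=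
    { toFun := fun x => ⟨kmulHom k (x : Fin n → ℤ), hκmem x⟩
      map_add' := fun x y => by ext1; simp
      map_smul' := fun c x => by
        apply Subtype.ext
        change kmulHom k (c • (x : Fin n → ℤ)) = c • kmulHom k (x : Fin n → ℤ)
        exact map_zsmul _ _ _ }
  have hκ : ∀ x : ↥Φ.toIntSubmodule, ((κ x : ↥L₁.toIntSubmodule) : Fin n → ℤ) = kmulHom k (x : Fin n → ℤ) :=
    fun x => rfl
  have hκinj : Function.Injective κ := fun x y hxy => by
    apply Subtype.ext
    exact kmulHom_injective hk (congrArg (fun z : ↥L₁.toIntSubmodule => (z : Fin n → ℤ)) hxy)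
  have hκsurj : Function.Surjective κ := by
    rintro ⟨y, ⟨χ, rfl⟩, hy⟩
    exact ⟨⟨χ, hy⟩, rfl⟩
  let κe : ↥Φ.toIntSubmodule ≃ₗ[ℤ] ↥L₁.toIntSubmodule := LinearEquiv.ofBijective κ ⟨hκinj, hκsurj⟩
  let b₁ : Basis (Fin r) ℤ ↥L₁.toIntSubmodule := b.map κe
  have hb₁ : ∀ i, ((b₁ i : ↥L₁.toIntSubmodule) : Fin n → ℤ) = kmulHom k (M i) := fun i => by
    show ((κ (b i) : ↥L₁.toIntSubmodule) : Fin n → ℤ) = _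
    rw [hκ, hMi]
  -- the index as a determinant
  have hidx := AddSubgroup.relIndex_eq_natAbs_det L₁ Φ' hle b₁ b'
  have hrel : (kmulHom k).range.relIndex Φ' = L₁.relIndex Φ' := by
    rw [hL₁, AddSubgroup.inf_relIndex_right]
  set v : Fin r → ↥Φ'.toIntSubmodule := fun i => ⟨(b₁ i : Fin n → ℤ), hle (SetLike.coe_mem _)⟩ with hv
  set A : Matrix (Fin r) (Fin r) ℤ := b'.toMatrix v with hA
  have hdetA : (kmulHom k).range.relIndex Φ' = A.det.natAbs := by rw [hrel, hidx, Basis.det_apply]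
  -- `kM = Aᵀ · M'`
  have hsum : ∀ j, ∑ i, A i j • (M' i) = kmulHom k (M j) := fun j => by
    have h := b'.sum_toMatrix_smul_self (v := v) (j := j)
    have h' := congrArg (fun z : ↥Φ'.toIntSubmodule => (z : Fin n → ℤ)) h
    simp only [Submodule.coe_sum, Submodule.coe_smul_of_tower, hb'] at h'
    rw [h', hv]
    exact hb₁ j
  have hKM : (Matrix.of fun i j => (k j : ℤ) * M i j) = A.transpose * M' := by
    ext j c
    have := congrFun (hsum j) c
    simp only [Finset.sum_apply, Pi.smul_apply, smul_eq_mul, kmulHom_apply] at this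
    rw [Matrix.of_apply, ← this, Matrix.mul_apply]
    rfl
  -- compare the minors
  rw [← absMinor_rowScale, hKM]
  by_cases hI : I.card = r
  · rw [absMinor_of_card_eq _ hI, absMinor_of_card_eq _ hI, hdetA,
      Matrix.submatrix_mul _ _ id id _ Function.bijective_id, Matrix.submatrix_id_id, Matrix.det_mul,
      Matrix.det_transpose, Int.natAbs_mul]
  · rw [absMinor_of_card_ne _ hI, absMinor_of_card_ne _ hI, mul_zero]

end GaGm

end Literature.NumberTheory.Transcendental
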